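import Literature.MathematicalPhysics.QuantumFieldTheory.Balaban1983to89.B8Eq184Proof

/-!
# `Balaban1983to89.B8Eq1110Concrete` — T. Bałaban, *Spaces of regular gauge field configurations on a lattice and gauge fixing
# conditions*, Commun. Math. Phys. **99** (1985) 75–102 [Balaban1985RegularSpaces] ("B8"), proof of Theorem 4, **(1.110)–(1.111)
# p. 95**: the bound on `(1/iη) log(U₁^{u′⁻¹})_b` from (1.108) and the representation (1.84) — i.e. the hypothesis (1.41) of
# Proposition 3 for the gauge-fixed field, with the constant `C′₁` — ON THE CONCRETE `ℤᵈ` CARRIERS, pointwise, explicit constants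

statement-level skeleton of published theorems with citation tags; proofs where landed; nothing here is a claim about the
Yang–Mills mass gap

PDF held: `paper:balaban1985-cmp99-regular-spaces-gauge-fixing` (journal page = PDF page + 74); p. 95 [PDF 21] on the text layer and
the x2 render `…/b2b-balaban-ref1/pages/1985-cmp99-regular-spaces-gauge-fixing/…-p021-x2.png` (this seat, 2026-08-25); (1.84)–(1.85) p. 90
as quoted and proved on the lattice in `B8Eq184Proof` / `B8Eq182Proof`.

WHAT IS PRINTED (p. 95, verbatim up to the garbled display): "The bounds (1.108) and the representation (1.84) imply
`|(1/iη) log(U₁^{u′⁻¹})_b| ≦ |A_b| + |g(i ad_{λ(b₋)})(Dλ)(b)| + O(1)η|(Dλ)(b)||A_b| < … (1.110)` [on `Ω_j`, `j = 0, 1, …, k − 1`],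
hence `|(1/iη) log(U₁^{u′⁻¹})_b| < C′₁B₁(α₀ + α₁)(Lʲη)⁻¹` on `Ω_j`, `j = 0, 1, …, k`, (1.111) where `C′₁` is an absolute constant
depending on `d` and `L` only. Thus all the assumptions of Proposition 3 are satisfied and for `α₀ + α₁` sufficiently small it implies
Theorem 4, except the uniqueness statement."  Inputs: (1.108) "`|λ|, |Dλ|₍₋₁₎ < 8B′₀B₁(α₀ + α₁)`" (p. 94), i.e. `|λ(x)| < α₄`,
`|(Dλ)(b)| < α₄(Lʲη)⁻¹` on `Ω_j` with `α₄ = 8B′₀B₁(α₀ + α₁)`; (1.69) "`|A| < B₁(α₀ + α₁)(Lʲη)⁻¹` on `Ω_j`, `j ≤ k − 1`"; and the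
cell's located reading of the constant (`B8.lean` `Thm4Skeleton.E110`): `C′₁ = (2 + 16B′₀)L`, the factor `L` from reading the `Ω_{k−1}`
bound on `Ω_k ⊂ Ω_{k−1}` (`(L^{k−1}η)⁻¹ = L(Lᵏη)⁻¹`).

WHAT THE TREE HAD.  (1.84) with the remainder bounds (1.83)/(1.85) on the lattice (`B8Eq184Proof.eq184_printed`: constants `41`, `17`;
`B8Eq182Proof.norm_gAd_le`: `|g(i ad_Y)X| ≤ 7|X|` on `|X| < 1/3`); (1.110)–(1.111) only as the ABSTRACT slot `E110` of `B8.Thm4Skeleton` /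
the hypothesis shapes of `B8.thm4Unique_of_prop5R` (row B8.Eq1.111: «C′₁ bookkeeping inside `B8.Thm4Skeleton`»).  THIS FILE derives the
displayed bound on the concrete carriers, pointwise at a bond, with explicit constants.

WHAT THIS FILE PROVES (kernel, 0 sorry, theorems only, no `def`).
* §1 `norm_gAd_le_of_small` — `|g(i ad_Y)X| ≤ 7|X|` for ALL `X` once `|Y| ≤ 1/12` (real homogeneity `B8Eq182Proof.gAd_smul_real` removes
  the radius condition of `norm_gAd_le`; needed because `(Dλ)(b)` is large on the fine levels, only `η(Dλ)(b)` is small).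
* §2 **`ineq1110_pointwise`** — (1.110) at one bond `b = ⟨x, x + e_μ⟩`: for `η > 0`, `|λ(x)| ≤ 1/12`, `η|(Dλ)(b)| ≤ 1/70`, `η|A_b| ≤ 1/12`,
  `|(1/iη) log(U₁^{u′⁻¹})_b| ≤ (6/5)|A_b| + 7|(Dλ)(b)| + η(41|(Dλ)(b)|² + 17|A_b||(Dλ)(b)|)` — print's three terms with the tree's constants
  (`6/5` = the non-unitary cost of `R(u′⁻¹(b₋))` on `|λ| ≤ 1/12`; `1` for unitary `u′`).
* §3 **`ineq1110_scaled`** — with the scaled inputs of (1.69)/(1.108) at a bond of `Ω_j`: `|A_b| ≤ c·t`, `|(Dλ)(b)| ≤ α₄·t`, `|λ(x)| ≤ α₄`,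
  `t = (Lʲη)⁻¹`, `ηt ≤ 1` (i.e. `L^{−j} ≤ 1`), and the smallness `α₄ ≤ 1/84`, `ηα₄t ≤ 1/70`, `ηct ≤ 1/12`: `|(1/iη) log(U₁^{u′⁻¹})_b| ≤ (2c + 8α₄)·t`;
  **`ineq1110_printed`** — at `α₄ = 8B′₀c` (`c = B₁(α₀ + α₁)`, (1.108)): `≤ (2 + 64B′₀)·c·(Lʲη)⁻¹` — (1.110) with the explicit
  `C″₁ = 2 + 64B′₀` (print `2 + 16B′₀`: its `|g(i ad)| ≈ 1` against the tree's `7`, absorbed as declared).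
* §4 **`ineq1111_of_1110`** — (1.111) from (1.110): a bound `X ≤ C·c·(L^{j′}η)⁻¹` read at most one level up (`j ≤ j′ + 1`, `L ≥ 1`) is
  `X ≤ C·L·c·(Lʲη)⁻¹`; so (1.110) on `Ω_j`, `j ≤ k − 1`, gives (1.111) on `Ω_j`, `j ≤ k` (`Ω_k ⊂ Ω_{k−1}`) with `C′₁ = C″₁·L`.

READINGS / DECLARED DEVIATIONS: `ℤᵈ` carriers and the conventions of `B8Eq184Proof` (`U₁ = e^{iηA}` = `cfgExp η A`, `u′ = e^{iλ}` = `gaugeExp λ`,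
`U₁^{u′⁻¹}` in the moving frame (55) of [3] = `mgauge U₀ (u′)⁻¹ U₁`, `log` = the series (21) of [3], `(Dλ)(b) = B8Ineq132.covDerivFwd`, print's `i`
kept); (1.84) with the `η𝔉₁` term kept (G-B8-02); `𝔸` any complete normed `ℂ`-algebra with `‖1‖ = 1` (no unitarity used: the factor `6/5`);
constants explicit and merely sufficient (`C″₁ = 2 + 64B′₀`, `C′₁ = C″₁L`); `<` typed `≤`; the statements are POINTWISE at a bond (the
domains `Ω_j` enter only through the scale `t = (Lʲη)⁻¹` of the hypotheses), so no locality issue arises.  NOT CLAIMED: (1.108) itself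
(Proposition 5), the application of Proposition 3, anything of Theorem 4.  Unit `pub-ymgap-dag-n04-b` (YM Track A, node N05 [B8]),
2026-08-25.  Tree API by name only (`B8Eq184Proof.eq184`, `B8Eq182Proof.norm_gAd_le`/`gAd_smul_real`/`norm_frakF1_le`/`norm_frakF2_le`),
nothing restated.
-/

noncomputable section

open NormedSpace
open Complex (I)

namespace Literature.MathematicalPhysics.QuantumFieldTheory.Balaban1983to89.B8Eq1110Concrete

open MatrixLog B7Prop1Explicit B7Eq92Concrete
open B7Eq78Linearization (conjR conjR_apply)
open B8Ineq132 (covDerivFwd)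
open B8Eq182Proof (gAd gAd_smul_real norm_gAd_le frakF1 frakF2 norm_frakF1_le norm_frakF2_le)
open B8Eq184Proof (gaugeExp cfgExp eq184)

-- `Site` alone could resolve to the torus sites of `Setup.lean`; re-export the `ℤ^d` sites of `B7Prop1Explicit`.
export B7Prop1Explicit (Site)

variable {d : ℕ}
variable {𝔸 : Type*} [NormedRing 𝔸] [NormedAlgebra ℂ 𝔸] [NormOneClass 𝔸] [CompleteSpace 𝔸]

/-! ## §1 `|g(i ad_Y)X| ≤ 7|X|` for all `X` -/

/-- **`|g(i ad_{λ(b₋)})(Dλ)(b)| ≤ 7|(Dλ)(b)|` WITHOUT a size condition on `(Dλ)(b)`** (`|λ(b₋)| ≤ 1/12`): `B8Eq182Proof.norm_gAd_le` gives it for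
`|X| < 1/3`, and `g(i ad_Y)` is real-homogeneous in `X` (`gAd_smul_real`), so the bound scales to every `X` — as it must for (1.110), where
only `η(Dλ)(b)`, not `(Dλ)(b)`, is small. [cite: Balaban1985RegularSpaces, (1.84) p.90, (1.110) p.95] -/
theorem norm_gAd_le_of_small (X : 𝔸) {Y : 𝔸} (hY : ‖Y‖ ≤ 1 / 12) : ‖gAd X Y‖ ≤ 7 * ‖X‖ := by
  by_cases hX : ‖X‖ = 0
  · have hX0 : X = 0 := norm_eq_zero.mp hX
    have h0 : gAd (0 : 𝔸) Y = 0 := by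
      have := gAd_smul_real (0 : ℝ) (0 : 𝔸) hY
      rwa [zero_smul, zero_smul] at this
    rw [hX0, h0, norm_zero]
    simp
  · have hXpos : 0 < ‖X‖ := lt_of_le_of_ne (norm_nonneg X) (Ne.symm hX)
    -- rescale to the radius `1/4 < 1/3`
    set t : ℝ := (1 / 4) * ‖X‖⁻¹ with ht
    have htpos : 0 < t := by positivity
    have hnorm : ‖(t • X : 𝔸)‖ = 1 / 4 := by
      rw [norm_smul, Real.norm_eq_abs, abs_of_pos htpos, ht, mul_assoc, inv_mul_cancel₀ hX, mul_one]
    have h := norm_gAd_le (X := t • X) (Y := Y) (by rw [hnorm]; norm_num) hY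
    rw [gAd_smul_real t X hY, norm_smul, Real.norm_eq_abs, abs_of_pos htpos, hnorm] at h
    -- `t‖gAd X Y‖ ≤ 7/4` with `t = 1/(4‖X‖)`
    have h2 : ‖gAd X Y‖ * (1 / 4) ≤ 7 * ‖X‖ * (1 / 4) := by
      have : t * ‖gAd X Y‖ * ‖X‖ ≤ 7 * (1 / 4) * ‖X‖ := mul_le_mul_of_nonneg_right h (norm_nonneg X)
      calc ‖gAd X Y‖ * (1 / 4) = t * ‖gAd X Y‖ * ‖X‖ := by rw [ht]; field_simp
        _ ≤ 7 * (1 / 4) * ‖X‖ := this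
        _ = 7 * ‖X‖ * (1 / 4) := by ring
    linarith

/-! ## §2 (1.110) at one bond -/

/-- `‖e^{a}‖ ≤ e^{‖a‖}` (from the tree's `‖e^{a} − 1‖ ≤ e^{‖a‖} − 1`, `Literature.Analysis.Calculus.norm_exp_sub_one_le`). [folklore] -/
private theorem norm_exp_le_rexp (a : 𝔸) : ‖exp a‖ ≤ Real.exp ‖a‖ := by
  have h := Literature.Analysis.Calculus.norm_exp_sub_one_le a
  calc ‖exp a‖ = ‖(exp a - 1) + 1‖ := by rw [sub_add_cancel]
    _ ≤ ‖exp a - 1‖ + ‖(1 : 𝔸)‖ := norm_add_le _ _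
    _ ≤ (Real.exp ‖a‖ - 1) + 1 := by rw [norm_one]; linarith
    _ = Real.exp ‖a‖ := by ring

/-- The non-unitary cost of the rotation `R(u′⁻¹(b₋))`, `u′ = e^{iλ}`, `|λ(b₋)| ≤ 1/12`: `|R(e^{−iλ})V| ≤ e^{1/6}|V| ≤ (6/5)|V|` (for unitary
`u′` the factor is `1`). [cite: Balaban1985RegularSpaces, (1.84) p.90] -/
private theorem norm_conjR_gaugeExp_inv_le {lam : Site d → 𝔸} {x : Site d} (hl : ‖lam x‖ ≤ 1 / 12) (V : 𝔸) :
    ‖conjR (gaugeExp lam x)⁻¹ V‖ ≤ 6 / 5 * ‖V‖ := by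
  have hZ : ‖(-(I • lam x) : 𝔸)‖ ≤ 1 / 12 := by rwa [norm_neg, norm_smul, Complex.norm_I, one_mul]
  have hZ' : ‖(I • lam x : 𝔸)‖ ≤ 1 / 12 := by rwa [norm_smul, Complex.norm_I, one_mul]
  rw [gaugeExp, val_inv_expUnit, conjR_apply, val_inv_expUnit, val_expUnit, val_expUnit, neg_neg]
  have h1 : ‖exp (-(I • lam x) : 𝔸)‖ ≤ Real.exp (1 / 12) := (norm_exp_le_rexp _).trans (Real.exp_le_exp.mpr hZ)
  have h2 : ‖exp (I • lam x : 𝔸)‖ ≤ Real.exp (1 / 12) := (norm_exp_le_rexp _).trans (Real.exp_le_exp.mpr hZ')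
  have hE : Real.exp (1 / 12) * Real.exp (1 / 12) ≤ 6 / 5 := by
    rw [← Real.exp_add, show (1 : ℝ) / 12 + 1 / 12 = 1 / 6 by norm_num]
    have h := Real.exp_bound_div_one_sub_of_interval' (x := 1 / 6) (by norm_num) (by norm_num)
    linarith [show (1 : ℝ) / (1 - 1 / 6) = 6 / 5 by norm_num]
  calc ‖exp (-(I • lam x)) * V * exp (I • lam x)‖ ≤ ‖exp (-(I • lam x) : 𝔸)‖ * ‖V‖ * ‖exp (I • lam x : 𝔸)‖ :=
        (norm_mul_le _ _).trans (mul_le_mul_of_nonneg_right (norm_mul_le _ _) (norm_nonneg _))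
    _ ≤ Real.exp (1 / 12) * ‖V‖ * Real.exp (1 / 12) := by gcongr
    _ = Real.exp (1 / 12) * Real.exp (1 / 12) * ‖V‖ := by ring
    _ ≤ 6 / 5 * ‖V‖ := mul_le_mul_of_nonneg_right hE (norm_nonneg V)

/-- **(1.110) AT ONE BOND, CONCRETE** (p. 95: "The bounds (1.108) and the representation (1.84) imply `|(1/iη) log(U₁^{u′⁻¹})_b| ≦ |A_b| +
|g(i ad_{λ(b₋)})(Dλ)(b)| + O(1)η|(Dλ)(b)||A_b| < …`"): for `η > 0`, `U₁ = e^{iηA}`, `u′ = e^{iλ}` and a bond `b = ⟨x, x + e_μ⟩` with `|λ(x)| ≤ 1/12`,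
`η|(Dλ)(b)| ≤ 1/70`, `η|A_b| ≤ 1/12` (the small quantities of (1.108)/(1.69) in lattice units), the moving-frame bond variable of `U₁^{u′⁻¹}`
satisfies `|(1/iη) log(U₁^{u′⁻¹})_b| ≤ (6/5)|A_b| + 7|(Dλ)(b)| + η(41|(Dλ)(b)|² + 17|A_b||(Dλ)(b)|)` — the three printed terms (with the tree's
`η𝔉₁` of (1.82) kept, G-B8-02) and explicit constants (`B8Eq184Proof.eq184`, `B8Eq182Proof`). [cite: Balaban1985RegularSpaces, (1.110) p.95, (1.84)–(1.85) p.90] -/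
theorem ineq1110_pointwise {η : ℝ} (hη : 0 < η) (U₀ : Site d → Fin d → 𝔸ˣ) {lam : Site d → 𝔸} (A : Site d → Fin d → 𝔸)
    {x : Site d} (μ : Fin d) (hl : ‖lam x‖ ≤ 1 / 12) (hD : η * ‖covDerivFwd η U₀ μ lam x‖ ≤ 1 / 70)
    (hA : η * ‖A x μ‖ ≤ 1 / 12) :
    ‖η⁻¹ • ((I⁻¹ : ℂ) • mlog ((mgauge U₀ (fun y => (gaugeExp lam y)⁻¹) (cfgExp η A) x μ : 𝔸ˣ) : 𝔸))‖
      ≤ 6 / 5 * ‖A x μ‖ + 7 * ‖covDerivFwd η U₀ μ lam x‖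
        + η * (41 * ‖covDerivFwd η U₀ μ lam x‖ ^ 2 + 17 * ‖A x μ‖ * ‖covDerivFwd η U₀ μ lam x‖) := by
  rw [eq184 hη U₀ A μ hl hD]
  have h1 := norm_conjR_gaugeExp_inv_le hl (A x μ)
  have h2 := norm_gAd_le_of_small (covDerivFwd η U₀ μ lam x) hl
  have h3 := norm_frakF1_le hη hl (D := covDerivFwd η U₀ μ lam x) (by linarith)
  have h4 := norm_frakF2_le hη hl hD hA
  have hη' : ‖(η : ℝ)‖ = η := by rw [Real.norm_eq_abs, abs_of_pos hη]
  calc _ ≤ ‖conjR (gaugeExp lam x)⁻¹ (A x μ)‖ + ‖gAd (covDerivFwd η U₀ μ lam x) (lam x)‖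
          + ‖η • frakF1 η (lam x) (covDerivFwd η U₀ μ lam x)‖
          + ‖η • frakF2 η (lam x) (covDerivFwd η U₀ μ lam x) (A x μ)‖ := norm_add₄_le
    _ ≤ 6 / 5 * ‖A x μ‖ + 7 * ‖covDerivFwd η U₀ μ lam x‖
          + η * (41 * ‖covDerivFwd η U₀ μ lam x‖ ^ 2) + η * (17 * ‖A x μ‖ * ‖covDerivFwd η U₀ μ lam x‖) := by
        rw [norm_smul, norm_smul, hη']
        gcongr
    _ = _ := by ring

/-! ## §3 (1.110) with the scaled inputs (1.69), (1.108) on `Ω_j` -/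

/-- **(1.110) WITH THE SCALED INPUTS** — at a bond `b` of `Ω_j` with `t = (Lʲη)⁻¹`: (1.69) `|A_b| ≤ c·t` (`c = B₁(α₀ + α₁)`), (1.108)
`|λ(b₋)| ≤ α₄`, `|(Dλ)(b)| ≤ α₄·t` (`α₄ = 8B′₀B₁(α₀ + α₁)`), with `ηt ≤ 1` (`= L^{−j}`) and the smallness `α₄ ≤ 1/84`, `η·α₄t ≤ 1/70`,
`η·ct ≤ 1/12` ("for `α₀ + α₁` sufficiently small"): `|(1/iη) log(U₁^{u′⁻¹})_b| ≤ (2c + 8α₄)·t` — the remainders `η(41|Dλ|² + 17|A||Dλ|) ≤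
ηt·(41α₄ + 17c)α₄·t ≤ (α₄/2 + c/2)·t` absorbed into print's "`<`". [cite: Balaban1985RegularSpaces, (1.110) p.95, (1.108) p.94, (1.69) p.88] -/
theorem ineq1110_scaled {η : ℝ} (hη : 0 < η) (U₀ : Site d → Fin d → 𝔸ˣ) {lam : Site d → 𝔸} (A : Site d → Fin d → 𝔸)
    {x : Site d} (μ : Fin d) {c α₄ t : ℝ} (hc : 0 ≤ c) (hα₄ : 0 ≤ α₄) (ht : 0 ≤ t) (hηt : η * t ≤ 1)
    (hl : ‖lam x‖ ≤ α₄) (hD : ‖covDerivFwd η U₀ μ lam x‖ ≤ α₄ * t) (hA : ‖A x μ‖ ≤ c * t)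
    (hs₁ : α₄ ≤ 1 / 84) (hs₂ : η * (α₄ * t) ≤ 1 / 70) (hs₃ : η * (c * t) ≤ 1 / 12) :
    ‖η⁻¹ • ((I⁻¹ : ℂ) • mlog ((mgauge U₀ (fun y => (gaugeExp lam y)⁻¹) (cfgExp η A) x μ : 𝔸ˣ) : 𝔸))‖
      ≤ (2 * c + 8 * α₄) * t := by
  have hDn := norm_nonneg (covDerivFwd η U₀ μ lam x)
  have hAn := norm_nonneg (A x μ)
  have hl' : ‖lam x‖ ≤ 1 / 12 := hl.trans (hs₁.trans (by norm_num))
  have hD' : η * ‖covDerivFwd η U₀ μ lam x‖ ≤ 1 / 70 := (mul_le_mul_of_nonneg_left hD hη.le).trans hs₂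
  have hA' : η * ‖A x μ‖ ≤ 1 / 12 := (mul_le_mul_of_nonneg_left hA hη.le).trans hs₃
  refine (ineq1110_pointwise hη U₀ A μ hl' hD' hA').trans ?_
  -- the two remainders: `η·41|D|² ≤ 41α₄·(ηt)·α₄t ≤ (α₄/2)t`, `η·17|A||D| ≤ 17c(ηt)α₄ t ≤ (c/2) t`
  have r1 : η * (41 * ‖covDerivFwd η U₀ μ lam x‖ ^ 2) ≤ α₄ / 2 * t := by
    have h1 : ‖covDerivFwd η U₀ μ lam x‖ ^ 2 ≤ (α₄ * t) ^ 2 := pow_le_pow_left₀ hDn hD 2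
    have h2 : η * (41 * (α₄ * t) ^ 2) = 41 * α₄ * (η * t) * (α₄ * t) := by ring
    have h3 : 41 * α₄ * (η * t) ≤ 1 / 2 := by
      have : 41 * α₄ * (η * t) ≤ 41 * α₄ * 1 := mul_le_mul_of_nonneg_left hηt (by positivity)
      linarith
    calc η * (41 * ‖covDerivFwd η U₀ μ lam x‖ ^ 2) ≤ η * (41 * (α₄ * t) ^ 2) := by gcongr
      _ = 41 * α₄ * (η * t) * (α₄ * t) := h2
      _ ≤ 1 / 2 * (α₄ * t) := mul_le_mul_of_nonneg_right h3 (by positivity)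
      _ = α₄ / 2 * t := by ring
  have r2 : η * (17 * ‖A x μ‖ * ‖covDerivFwd η U₀ μ lam x‖) ≤ c / 2 * t := by
    have h2 : η * (17 * (c * t) * (α₄ * t)) = 17 * α₄ * (η * t) * (c * t) := by ring
    have h3 : 17 * α₄ * (η * t) ≤ 1 / 2 := by
      have : 17 * α₄ * (η * t) ≤ 17 * α₄ * 1 := mul_le_mul_of_nonneg_left hηt (by positivity)
      linarith
    calc η * (17 * ‖A x μ‖ * ‖covDerivFwd η U₀ μ lam x‖) ≤ η * (17 * (c * t) * (α₄ * t)) := by gcongr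
      _ = 17 * α₄ * (η * t) * (c * t) := h2
      _ ≤ 1 / 2 * (c * t) := mul_le_mul_of_nonneg_right h3 (by positivity)
      _ = c / 2 * t := by ring
  have m1 : 6 / 5 * ‖A x μ‖ ≤ 6 / 5 * (c * t) := by gcongr
  have m2 : 7 * ‖covDerivFwd η U₀ μ lam x‖ ≤ 7 * (α₄ * t) := by gcongr
  calc 6 / 5 * ‖A x μ‖ + 7 * ‖covDerivFwd η U₀ μ lam x‖
        + η * (41 * ‖covDerivFwd η U₀ μ lam x‖ ^ 2 + 17 * ‖A x μ‖ * ‖covDerivFwd η U₀ μ lam x‖)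
      = 6 / 5 * ‖A x μ‖ + 7 * ‖covDerivFwd η U₀ μ lam x‖
        + (η * (41 * ‖covDerivFwd η U₀ μ lam x‖ ^ 2) + η * (17 * ‖A x μ‖ * ‖covDerivFwd η U₀ μ lam x‖)) := by ring
    _ ≤ 6 / 5 * (c * t) + 7 * (α₄ * t) + (α₄ / 2 * t + c / 2 * t) := by gcongr
    _ ≤ (2 * c + 8 * α₄) * t := by nlinarith

/-- **(1.110) IN PRINT'S LETTERS** — with (1.108)'s `α₄ = 8B′₀B₁(α₀ + α₁) = 8B′₀c`: `|(1/iη) log(U₁^{u′⁻¹})_b| ≤ (2 + 64B′₀)·c·(Lʲη)⁻¹` at every bond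
of `Ω_j`, `j ≤ k − 1` — (1.110) with the EXPLICIT `C″₁ = 2 + 64B′₀` (print: `2 + 16B′₀`, its `|g(i ad_λ)| ≈ 1` against the tree's constant `7`
of `B8Eq182Proof.norm_gAd_le`, declared). [cite: Balaban1985RegularSpaces, (1.110) p.95, (1.108) p.94] -/
theorem ineq1110_printed {η : ℝ} (hη : 0 < η) (U₀ : Site d → Fin d → 𝔸ˣ) {lam : Site d → 𝔸} (A : Site d → Fin d → 𝔸)
    {x : Site d} (μ : Fin d) {c B₀' t : ℝ} (hc : 0 ≤ c) (hB₀' : 0 ≤ B₀') (ht : 0 ≤ t) (hηt : η * t ≤ 1)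
    (hl : ‖lam x‖ ≤ 8 * B₀' * c) (hD : ‖covDerivFwd η U₀ μ lam x‖ ≤ 8 * B₀' * c * t) (hA : ‖A x μ‖ ≤ c * t)
    (hs₁ : 8 * B₀' * c ≤ 1 / 84) (hs₂ : η * (8 * B₀' * c * t) ≤ 1 / 70) (hs₃ : η * (c * t) ≤ 1 / 12) :
    ‖η⁻¹ • ((I⁻¹ : ℂ) • mlog ((mgauge U₀ (fun y => (gaugeExp lam y)⁻¹) (cfgExp η A) x μ : 𝔸ˣ) : 𝔸))‖
      ≤ (2 + 64 * B₀') * c * t := by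
  have h := ineq1110_scaled hη U₀ A μ hc (by positivity : (0 : ℝ) ≤ 8 * B₀' * c) ht hηt hl hD hA hs₁ hs₂ hs₃
  refine h.trans (le_of_eq ?_)
  ring

/-! ## §4 (1.111) from (1.110): one level up costs a factor `L` -/

/-- **(1.111) FROM (1.110)** (p. 95: "hence `|(1/iη) log(U₁^{u′⁻¹})_b| < C′₁B₁(α₀ + α₁)(Lʲη)⁻¹` on `Ω_j`, `j = 0, 1, …, k`, (1.111)"): (1.110) is
available on `Ω_{j′}`, `j′ ≤ k − 1`; a bond of `Ω_j`, `j ≤ k`, lies in `Ω_{j′}` with `j′ = min(j, k − 1)`, `j ≤ j′ + 1`, and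
`(L^{j′}η)⁻¹ ≤ L·(Lʲη)⁻¹` for `L ≥ 1` — so a bound `X ≤ C·c·(L^{j′}η)⁻¹` becomes `X ≤ (C·L)·c·(Lʲη)⁻¹`: `C′₁ = C″₁L` ("an absolute constant
depending on `d` and `L` only"). [cite: Balaban1985RegularSpaces, (1.111) p.95] -/
theorem ineq1111_of_1110 {L : ℕ} (hL : 1 ≤ L) {η : ℝ} (hη : 0 < η) {X C c : ℝ} (hC : 0 ≤ C) (hc : 0 ≤ c) {j j' : ℕ}
    (hj' : j ≤ j' + 1) (h : X ≤ C * c * ((L : ℝ) ^ j' * η)⁻¹) :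
    X ≤ C * L * c * ((L : ℝ) ^ j * η)⁻¹ := by
  have hLr : (1 : ℝ) ≤ L := by exact_mod_cast hL
  have hL0 : (0 : ℝ) < L := by linarith
  have hpos : (0 : ℝ) < (L : ℝ) ^ j * η := by positivity
  have hpos' : (0 : ℝ) < (L : ℝ) ^ j' * η := by positivity
  -- `(L^{j′}η)⁻¹ ≤ L (Lʲη)⁻¹` since `Lʲ ≤ L·L^{j′}`
  have hle : (L : ℝ) ^ j * η ≤ L * ((L : ℝ) ^ j' * η) := by
    calc (L : ℝ) ^ j * η ≤ (L : ℝ) ^ (j' + 1) * η := mul_le_mul_of_nonneg_right (pow_le_pow_right₀ hLr hj') hη.le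
      _ = L * ((L : ℝ) ^ j' * η) := by ring
  have hkey : ((L : ℝ) ^ j' * η)⁻¹ ≤ L * ((L : ℝ) ^ j * η)⁻¹ := by
    have e : ((L : ℝ) ^ j' * η)⁻¹ = L * (L * ((L : ℝ) ^ j' * η))⁻¹ := by
      field_simp
    rw [e]
    exact mul_le_mul_of_nonneg_left (inv_anti₀ hpos hle) hL0.le
  calc X ≤ C * c * ((L : ℝ) ^ j' * η)⁻¹ := h
    _ ≤ C * c * (L * ((L : ℝ) ^ j * η)⁻¹) := mul_le_mul_of_nonneg_left hkey (by positivity)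
    _ = C * L * c * ((L : ℝ) ^ j * η)⁻¹ := by ring

end Literature.MathematicalPhysics.QuantumFieldTheory.Balaban1983to89.B8Eq1110Concrete

end
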